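import Literature.NumberTheory.Weil1964.AdelicMetaplecticFinRep
import Literature.NumberTheory.Weil1964.AdelicMetaplecticReindex
import HarnessLib

/-!
# The finite factor `ω_f` of a REINDEXED splitting is the reindexed finite factor: `ω_f(R_e ∘ s) = R_e^f ∘ ω_f(s) ∘ (R_e^f)⁻¹`

Topic `NumberTheory/Weil1964`; namespace `Literature.NumberTheory.Weil1964`.  THEOREMS ONLY (no definition, no named fact, no
instance, no `sorry`).  Cell `hodgecm-mathlib`, (β)-glue of `A-plan/GS6-HOIST-SPEC.md` §9, piece (f1-up)(a) = placement-sheet row L-12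
(consumer: the G1-face (f1-adapted)); books 0: nothing here is a named fact or moves a binder of HC_CM.

SETTING ([Weil1964] Chap. III n° 37–38; [GelbartRogawski1991] §3.1 p. 454).  A number field `F`, an index bijection `e : ι ≃ ι′`,
an adelic Gram matrix `T ∈ M_ι(𝔸_F)` and its reindexing `reindex e e T ∈ M_{ι′}(𝔸_F)`, the REINDEXING OF RECORD
★ `adelicMpContReindex F e T : Mp_ψ(W_T)ᶜᵒⁿᵗ ≃* Mp_ψ(W_{reindex e e T})ᶜᵒⁿᵗ` (★ `AdelicMetaplecticReindex` §4: `(g, M) ↦ (W_e g W_e⁻¹,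
R_e M R_e⁻¹)`, `ω(reindex p) Ψ = R_e (ω(p) (R_e⁻¹ Ψ))`), and a homomorphism `s : H →* Mp_ψ(W_T)ᶜᵒⁿᵗ` whose symplectic components
fix the archimedean vectors (`harch`) — the hypothesis under which the FINITE FACTOR ★ `finRepMp hT s harch : H → End 𝒮((𝔸_F^∞)^ι)`
(`ω(s h) = 1 ⊗ finRepMp s h`, ★ `AdelicMetaplecticFinRep`) is defined.

RESULTS (all folklore bookkeeping on the two ★ files; cites point at the places where the objects are set up).
* §1 `archVec_comp_equiv`, `reindexW_symm_archVec_pair`, `reindexW_archVec_pair` — archimedean vectors under `W_e`;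
  **`archVec_fixed_reindex`** — the reindexed splitting `R_e ∘ s := (adelicMpContReindex F e T) ∘ s` again fixes the archimedean
  vectors (the `harch` transport), so its finite factor is defined; `isUnit_reindex` — `reindex e e T` is invertible when `T` is.
* §2 `schwartzReindexCLM_schwartzReindexCLM_symm`, `finSBReindex_symm`, `unitSchwartz_ne_zero` (plumbing);
  **`finRepMp_reindex_apply`** — `finRepMp (R_e ∘ s) h f = R_e^f (finRepMp s h ((R_e^f)⁻¹ f))` (★ `finRepMp_unique` against the test
  vector `Φ₀ = unitSchwartz`, computed with ★ `adelicMpCont.omega_reindex_apply`, ★ `piSBReindex_tmul` (×2) and ★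
  `omega_map_tmul_finRepMp`); **`finRepMp_reindex`** — the same as `finRepMp (R_e ∘ s) h = (R_e^f).conj (finRepMp s h)`;
  **`finSBReindex_finRepMp`** — `R_e^f` INTERTWINES `finRepMp s` with `finRepMp (R_e ∘ s)`.

USE: G1 ★ `finRepMp_comp_finSumEquiv` / `finSumEquiv_intertwines` (`AdelicMetaplecticFinRepBlockDiag`) live on `ι₁ ⊕ ι₂` with
`T = fromBlocks T₁ 0 0 T₂`; the rank-`(N₁+N₂)` pair splitting of ★ `UnitaryDualPairWeilCoinvariants.finPairRep` lives on `Fin n` with the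
Kronecker Gram matrix read through an enumeration `Fin (N₁+N₂) × Fin M ≃ Fin n`; this file is the transport of `finRepMp` along the index
shuffle between the two (the owner of (f1) composes it with the Gram-matrix identification and G1).

TECHNICAL NOTE (for the next hand): on these carriers `rw` with `reindexW_symm_apply` / `piSBReindex_symm` / `MonoidHom.coe_comp`
runs into `isDefEq`/`whnf` heartbeat time-outs (failed higher-order matches unfold the adelic instance towers); the proofs below
therefore go by `Eq.trans` / `congrArg` chains against the ★ `rfl`-lemmas, which elaborate in < 1 s each.

## References
* [Weil1964] A. Weil, *Sur certains groupes d'opérateurs unitaires*, Acta Math. 111 (1964), Chap. III n° 37–38 pp. 188–190.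
* [GelbartRogawski1991] S. Gelbart, J. Rogawski, Invent. Math. 105 (1991), §3.1 p. 454.
* [MoeglinVignerasWaldspurger1987] C. Mœglin, M.-F. Vignéras, J.-L. Waldspurger, LNM 1291 (1987), Chap. 2 I.4 Exemple (1), II.1.
-/

set_option autoImplicit false

noncomputable section

open scoped TensorProduct Classical
open NumberField NumberField.mixedEmbedding IsDedekindDomain
open Literature.NumberTheory.Automorphic Literature.RepresentationTheory.HeisenbergGroup
open Literature.NumberTheory.Automorphic.UnitaryGroup (reindexW reindexW_apply reindexW_symm_apply spReindex coe_spReindex_apply)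

namespace Literature.NumberTheory.Weil1964

variable {F : Type} [Field F] [NumberField F] {ι ι' : Type} [Fintype ι] [Fintype ι'] [DecidableEq ι] [DecidableEq ι']
  (e : ι ≃ ι')

/-! ### §1 Archimedean vectors under the reindexing; the `harch` transport -/

omit [Fintype ι] [Fintype ι'] [DecidableEq ι] [DecidableEq ι'] in
/-- `archVec a ∘ e = archVec (a ∘ e)` (both are `i ↦ (a (e i), 0)`). [cite: Weil1964, Chap. III n° 37 p. 188] -/
theorem archVec_comp_equiv (a : ι' → mixedSpace F) : archVec F ι' a ∘ e = archVec F ι (a ∘ e) := rfl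

omit [Fintype ι] [Fintype ι'] [DecidableEq ι] [DecidableEq ι'] in
/-- `W_e⁻¹ (archVec a, archVec w) = (archVec (a ∘ e), archVec (w ∘ e))`. [cite: MoeglinVignerasWaldspurger1987, Chap. 2 I.4 Exemple (1)] -/
theorem reindexW_symm_archVec_pair (a w : ι' → mixedSpace F) :
    (reindexW (AdeleRing (𝓞 F) F) e).symm (archVec F ι' a, archVec F ι' w) =
      (archVec F ι (a ∘ e), archVec F ι (w ∘ e)) := rfl

omit [Fintype ι] [Fintype ι'] [DecidableEq ι] [DecidableEq ι'] in
/-- `W_e (archVec b, archVec x) = (archVec (b ∘ e⁻¹), archVec (x ∘ e⁻¹))`. [cite: MoeglinVignerasWaldspurger1987, Chap. 2 I.4 Exemple (1)] -/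
theorem reindexW_archVec_pair (b x : ι → mixedSpace F) :
    reindexW (AdeleRing (𝓞 F) F) e (archVec F ι b, archVec F ι x) =
      (archVec F ι' (b ∘ e.symm), archVec F ι' (x ∘ e.symm)) := rfl

variable {T : Matrix ι ι (AdeleRing (𝓞 F) F)} {H : Type*} [Monoid H]

/-- **The `harch` transport**: if the symplectic components of `s` fix the archimedean vectors of `W_T`, those of the reindexed
splitting `(adelicMpContReindex F e T) ∘ s` fix the archimedean vectors of `W_{reindex e e T}` (`π(reindex p) = W_e π(p) W_e⁻¹`, ★
`adelicMpCont.proj_reindex`, and `W_e^{±1}` permutes archimedean vectors). [cite: GelbartRogawski1991, §3.1 p. 454] -/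
theorem archVec_fixed_reindex (s : H →* adelicMpCont F ι T)
    (harch : ∀ (h : H) (a w : ι → mixedSpace F),
      (adelicMpCont.proj F ι T (s h)).1 (archVec F ι a, archVec F ι w) = (archVec F ι a, archVec F ι w))
    (h : H) (a w : ι' → mixedSpace F) :
    (adelicMpCont.proj F ι' (Matrix.reindex e e T) (((adelicMpContReindex F e T).toMonoidHom.comp s) h)).1
        (archVec F ι' a, archVec F ι' w) = (archVec F ι' a, archVec F ι' w) := by
  have hc : ((adelicMpContReindex F e T).toMonoidHom.comp s) h = adelicMpContReindex F e T (s h) := rfl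
  rw [hc, adelicMpCont.proj_reindex]
  have h2 : (reindexW (AdeleRing (𝓞 F) F) e).symm (archVec F ι' a, archVec F ι' w) =
      (archVec F ι (a ∘ e), archVec F ι (w ∘ e)) := rfl
  have h3 : reindexW (AdeleRing (𝓞 F) F) e (archVec F ι (a ∘ e), archVec F ι (w ∘ e)) =
      (archVec F ι' ((a ∘ e) ∘ e.symm), archVec F ι' ((w ∘ e) ∘ e.symm)) := rfl
  have ha : (a ∘ e) ∘ e.symm = a := funext fun i => congrArg a (e.apply_symm_apply i)
  have hw : (w ∘ e) ∘ e.symm = w := funext fun i => congrArg w (e.apply_symm_apply i)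
  refine (coe_spReindex_apply e T _ _).trans ?_
  refine (congrArg (fun v => reindexW (AdeleRing (𝓞 F) F) e ((adelicMpCont.proj F ι T (s h)).1 v)) h2).trans ?_
  refine (congrArg (reindexW (AdeleRing (𝓞 F) F) e) (harch h (a ∘ e) (w ∘ e))).trans ?_
  refine h3.trans ?_
  rw [ha, hw]

omit [Fintype ι] [Fintype ι'] [DecidableEq ι] [DecidableEq ι'] in
/-- `reindex e e T` is invertible when `T` is (`Matrix.reindexAlgEquiv`). [cite: GelbartRogawski1991, §3.1 p. 454] -/
theorem isUnit_reindex [Fintype ι] [Fintype ι'] [DecidableEq ι] [DecidableEq ι'] (hT : IsUnit T) :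
    IsUnit (Matrix.reindex e e T) :=
  hT.map (Matrix.reindexAlgEquiv (AdeleRing (𝓞 F) F) (AdeleRing (𝓞 F) F) e)

/-! ### §2 The finite factor of the reindexed splitting -/

omit [DecidableEq ι] [DecidableEq ι'] in
/-- `R_e^∞ (R_{e⁻¹}^∞ φ) = φ`. [cite: MoeglinVignerasWaldspurger1987, Chap. 2 I.4 Exemple (1)] -/
theorem schwartzReindexCLM_schwartzReindexCLM_symm (φ : SchwartzMap (ι' → mixedSpace F) ℂ) :
    schwartzReindexCLM F e (schwartzReindexCLM F e.symm φ) = φ := by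
  ext w
  rw [schwartzReindexCLM_apply, schwartzReindexCLM_apply]
  exact congrArg φ (funext fun i => congrArg w (e.apply_symm_apply i))

omit [Fintype ι] [Fintype ι'] [DecidableEq ι] [DecidableEq ι'] in
/-- `(R_e^f)⁻¹ = R_{e⁻¹}^f`. [cite: MoeglinVignerasWaldspurger1987, Chap. 2 I.4 Exemple (1)] -/
theorem finSBReindex_symm : (finSBReindex F e).symm = finSBReindex F e.symm := rfl

omit [DecidableEq ι'] in
/-- the archimedean test vector `unitSchwartz` is non-zero (its value at `0` is `1`). [cite: Weil1964, Chap. III n° 37 p. 188] -/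
theorem unitSchwartz_ne_zero : unitSchwartz F ι' ≠ 0 := fun h0 => by
  have h1 := unitSchwartz_apply_zero (F := F) (ι := ι')
  rw [h0] at h1
  exact zero_ne_one h1

variable (hT : IsUnit T) (s : H →* adelicMpCont F ι T)
  (harch : ∀ (h : H) (a w : ι → mixedSpace F),
    (adelicMpCont.proj F ι T (s h)).1 (archVec F ι a, archVec F ι w) = (archVec F ι a, archVec F ι w))
  (hT' : IsUnit (Matrix.reindex e e T))
  (harch' : ∀ (h : H) (a w : ι' → mixedSpace F),
    (adelicMpCont.proj F ι' (Matrix.reindex e e T) (((adelicMpContReindex F e T).toMonoidHom.comp s) h)).1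
        (archVec F ι' a, archVec F ι' w) = (archVec F ι' a, archVec F ι' w))

/-- **`finRepMp (R_e ∘ s) h f = R_e^f (finRepMp s h ((R_e^f)⁻¹ f))`** — the finite factor of the reindexed splitting is the
reindexed finite factor.  Proof: by ★ `finRepMp_unique` it suffices to check `ω(reindex (s h)) (Φ₀ ⊗ f) = Φ₀ ⊗ R_e^f ω_f(s h) (R_e^f)⁻¹ f`
for ONE archimedean `Φ₀ ≠ 0`; by ★ `adelicMpCont.omega_reindex_apply` the left side is `R_e (ω(s h) (R_{e⁻¹} (Φ₀ ⊗ f)))`, and `R_e`,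
`R_{e⁻¹}` are pure-tensor operators (★ `piSBReindex_tmul`) between which ★ `omega_map_tmul_finRepMp` acts on the finite leg only;
`R_e^∞ R_{e⁻¹}^∞ Φ₀ = Φ₀`.  (Any two admissible `hT′`, `harch′` give the same operator.)
[cite: Weil1964, Chap. III n° 37–38 pp. 188–190] [cite: GelbartRogawski1991, §3.1 p. 454] -/
theorem finRepMp_reindex_apply (h : H) (f : FinSB F ι') :
    finRepMp hT' ((adelicMpContReindex F e T).toMonoidHom.comp s) harch' h f =
      finSBReindex F e (finRepMp hT s harch h ((finSBReindex F e).symm f)) := by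
  have key : ((finSBReindex F e : FinSB F ι ≃ₗ[ℂ] FinSB F ι') : FinSB F ι →ₗ[ℂ] FinSB F ι') ∘ₗ
        (finRepMp hT s harch h) ∘ₗ ((finSBReindex F e).symm : FinSB F ι' →ₗ[ℂ] FinSB F ι) =
      finRepMp hT' ((adelicMpContReindex F e T).toMonoidHom.comp s) harch' h := by
    refine finRepMp_unique hT' _ harch' h (unitSchwartz_ne_zero (F := F) (ι' := ι')) fun g => ?_
    have hc : ((adelicMpContReindex F e T).toMonoidHom.comp s) h = adelicMpContReindex F e T (s h) := rfl
    rw [hc]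
    -- `ω(reindex (s h)) Ψ = R_e (ω(s h) (R_{e⁻¹} Ψ))`
    refine (adelicMpCont.omega_reindex_apply F e T (s h) _).trans ?_
    -- `R_{e⁻¹} (Φ₀ ⊗ g) = R_{e⁻¹}^∞ Φ₀ ⊗ R_{e⁻¹}^f g` (`(R_e)⁻¹ = R_{e⁻¹}` definitionally, ★ `piSBReindex_symm`)
    refine (congrArg (fun Ψ => piSBReindex F e (adelicMpCont.omega F ι T (s h) Ψ))
      (piSBReindex_tmul F e.symm (unitSchwartz F ι') g)).trans ?_
    -- `ω(s h)` acts on the finite leg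
    refine (congrArg (piSBReindex F e) (omega_map_tmul_finRepMp hT s harch h _ _)).trans ?_
    -- `R_e (φ ⊗ g′) = R_e^∞ φ ⊗ R_e^f g′`, and `R_e^∞ R_{e⁻¹}^∞ Φ₀ = Φ₀`
    refine (piSBReindex_tmul F e _ _).trans ?_
    exact congrArg (fun φ => piSchwartzBruhatEquiv F ι'
      (φ ⊗ₜ[ℂ] finSBReindex F e (finRepMp hT s harch h (finSBReindex F e.symm g))))
      (schwartzReindexCLM_schwartzReindexCLM_symm e (unitSchwartz F ι'))
  exact (LinearMap.congr_fun key f).symm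

/-- **`finRepMp (R_e ∘ s) h = (R_e^f).conj (finRepMp s h)`** (`LinearEquiv.conj`: `R_e^f ∘ ω_f(s h) ∘ (R_e^f)⁻¹`).
[cite: Weil1964, Chap. III n° 37–38 pp. 188–190] [cite: GelbartRogawski1991, §3.1 p. 454] -/
theorem finRepMp_reindex (h : H) :
    finRepMp hT' ((adelicMpContReindex F e T).toMonoidHom.comp s) harch' h =
      (finSBReindex F e).conj (finRepMp hT s harch h) := by
  refine Eq.trans ?_ (LinearEquiv.conj_apply _ _).symm
  exact LinearMap.ext fun f => (finRepMp_reindex_apply e hT s harch hT' harch' h f).trans rfl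

/-- **`R_e^f` intertwines**: `R_e^f (finRepMp s h f) = finRepMp (R_e ∘ s) h (R_e^f f)`.
[cite: Weil1964, Chap. III n° 37–38 pp. 188–190] [cite: MoeglinVignerasWaldspurger1987, Chap. 2 II.1] -/
theorem finSBReindex_finRepMp (h : H) (f : FinSB F ι) :
    finSBReindex F e (finRepMp hT s harch h f) =
      finRepMp hT' ((adelicMpContReindex F e T).toMonoidHom.comp s) harch' h (finSBReindex F e f) := by
  rw [finRepMp_reindex_apply e hT s harch hT' harch' h, LinearEquiv.symm_apply_apply]

/-- **the canonical instance**: with `hT′ := isUnit_reindex e hT` and `harch′ := archVec_fixed_reindex e s harch` (the two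
admissibility data produced in §1), `finRepMp (R_e ∘ s) h f = R_e^f (finRepMp s h ((R_e^f)⁻¹ f))`. [cite: Weil1964, Chap. III n° 37–38 pp. 188–190] -/
theorem finRepMp_reindex_apply' (h : H) (f : FinSB F ι') :
    finRepMp (isUnit_reindex e hT) ((adelicMpContReindex F e T).toMonoidHom.comp s) (archVec_fixed_reindex e s harch) h f =
      finSBReindex F e (finRepMp hT s harch h ((finSBReindex F e).symm f)) :=
  finRepMp_reindex_apply e hT s harch _ _ h f

end Literature.NumberTheory.Weil1964

end
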